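import Literature.NumberTheory.EllipticCurves.HalfIntegralWeightThetaMultiplier
import Literature.NumberTheory.EllipticCurves.HalfIntegralWeightFormsThetaMultiplierProofs
import HarnessLib

/-!
# Tunnell's `g` as a product of theta functions and the theta-automorphy of `g θ_t` on `Γ₀(128)`

Fifth file of the theta-multiplier chain. We PROVE:

* `tunnellG_eq_thetaMul` — **`g = ½ (θ₁ - θ₄)(2 θ₃₂ - θ₈)`** for Tunnell's weight-`1` form
  `g(z) = ∑_{(m,n) ∈ ℤ²} (-1)ⁿ q^{(4m+1)² + 8n²}` (Thm 1, p. 326): the double series is the product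
  of `∑_m q^{(4m+1)²} = ½ ∑_{k odd} q^{k²} = ½ (θ(z) - θ(4z))` and
  `∑_n (-1)ⁿ q^{8n²} = 2θ(32z) - θ(8z)` (`hasSum_four_mul_add_one_sq`, `hasSum_sign_sq`).
* `tunnellG_smul` — for `γ = (a b; c d) ∈ SL₂(ℤ)`, `c > 0`, `128 ∣ c`:
  `g(γz) = χ₈(a) μ(γ, z)² g(z)` with `μ(γ, z) = (2ic/(cz + d))^{-1/2} G(a; c)` the multiplier of `θ`
  (from the six relations `θ_t(γz) = ε_t μ θ_t(z)` of `HalfIntegralWeightThetaMultiplier`).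
* `isThetaAutomorphic_tunnellForm_chi` (`t = 1, 4, 16`, character `χ₂ = tunnellChar`) and
  `isThetaAutomorphic_tunnellForm_triv` (`t = 2, 8, 32`, trivial character) — **the automorphy
  half of Tunnell's Theorem 2** (p. 327: `g θ_t` has weight `3/2`, level `128`, and character
  `χ₂` resp. trivial): `f(γz) θ(z)³ = χ(d) θ(γz)³ f(z)` for all `γ ∈ Γ₀(128)` in the sense of
  `Literature.NumberTheory.EllipticCurves.ModularForms.IsThetaAutomorphic`. The identity reduces to
  `χ₈(a) ε_t = χ(d)` (`ad ≡ 1 (mod 8)`); `c < 0` is reduced to `-γ`, and `c = 0` to translations.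

Holomorphy and the cusp conditions (membership in `S_{3/2}(128, χ)`) are the subject of the
sequel; this file does not use any unproved statement. (The closed-form multiplier
`θ(γz) = ε_d⁻¹ (c/d) √(cz+d) θ(z)` of `HalfIntegralWeightFormsThetaMultiplierProofs` is not needed:
only RATIOS of multipliers of the `θ_t` enter, and these are the Gauss-sum identities of
`HalfIntegralWeightGaussSums*`; that file is imported for `neg_mem_Gamma0` and, transitively,
`SL_neg_apply` only.)

## References

* J. B. Tunnell, *A classical Diophantine problem and modular forms of weight 3/2*, Invent. Math.
  72 (1983), Thm 1 (p. 326), Thm 2 (p. 327).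
* G. Shimura, Ann. of Math. 97 (1973), §1.
-/

noncomputable section

open scoped MatrixGroups

open UpperHalfPlane hiding I
open Complex Filter Topology CongruenceSubgroup

namespace Literature.NumberTheory.EllipticCurves.Tunnell1983

open Literature.NumberTheory.EllipticCurves.ModularForms

/-! ### Even/odd splittings of theta series -/

/-- The `q`-series of `θ_t` with general integer exponent form. [folklore] -/
theorem hasSum_thetaMul {t : ℕ} (ht : 0 < t) (z : ℍ) :
    HasSum (fun m : ℤ ↦ cexp (2 * Real.pi * I * ((t * m ^ 2 : ℤ) : ℂ) * z)) (thetaMul t z) :=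
  hasSum_thetaTerm t ht z

/-- Summability of `m ↦ e^{2πi t (u m + v)² z}` along an arithmetic progression (`t ≥ 1`).
[folklore] -/
theorem summable_cexp_sq_progression {t : ℕ} (ht : 0 < t) (z : ℍ) {u : ℤ} (hu : u ≠ 0) (v : ℤ) :
    Summable (fun m : ℤ ↦ cexp (2 * Real.pi * I * ((t * (u * m + v) ^ 2 : ℤ) : ℂ) * z)) := by
  have hinj : Function.Injective (fun m : ℤ ↦ u * m + v) := by
    intro m₁ m₂ h
    have : u * m₁ = u * m₂ := by linarith
    exact mul_left_cancel₀ hu this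
  exact (hasSum_thetaMul ht z).summable.comp_injective hinj

/-- **`∑_m e^{2πi t (2m+1)² z} = θ_t(z) - θ_{4t}(z)`** (the odd part of the series of `θ_t`; the even
part is the series of `θ_{4t}`). [folklore] -/
theorem hasSum_thetaMul_odd {t : ℕ} (ht : 0 < t) (z : ℍ) :
    HasSum (fun m : ℤ ↦ cexp (2 * Real.pi * I * ((t * (2 * m + 1) ^ 2 : ℤ) : ℂ) * z))
      (thetaMul t z - thetaMul (4 * t) z) := by
  have h4 : HasSum (fun m : ℤ ↦ cexp (2 * Real.pi * I * ((t * (2 * m) ^ 2 : ℤ) : ℂ) * z))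
      (thetaMul (4 * t) z) := by
    have := hasSum_thetaMul (t := 4 * t) (by omega) z
    convert this using 2 with m
    push_cast; ring_nf
  have ho := summable_cexp_sq_progression ht z two_ne_zero 1
  have htot := ModularForms.hasSum_int_even_add_odd
    (f := fun k : ℤ ↦ cexp (2 * Real.pi * I * ((t * k ^ 2 : ℤ) : ℂ) * z)) h4 ho.hasSum
  have := (hasSum_thetaMul ht z).unique htot
  rw [this, add_sub_cancel_left]
  exact ho.hasSum

/-- **`∑_m e^{2πi (4m+1)² z} = ½ (θ(z) - θ(4z))`**: the classes `4m + 1` and `4m + 3 = -(4(-m-1) + 1)`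
contribute equally to `∑_{k odd} q^{k²}`. [cite: Tunnell1983Congruent, Remark p. 327 context] -/
theorem hasSum_four_mul_add_one_sq (z : ℍ) :
    HasSum (fun m : ℤ ↦ cexp (2 * Real.pi * I * (((4 * m + 1) ^ 2 : ℤ) : ℂ) * z))
      ((thetaMul 1 z - thetaMul 4 z) / 2) := by
  -- `g(m) = e((2m+1)² z)`; even part `h(j) = e((4j+1)² z)`, odd part `h(-j-1)`
  have hg : HasSum (fun m : ℤ ↦ cexp (2 * Real.pi * I * ((1 * (2 * m + 1) ^ 2 : ℤ) : ℂ) * z))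
      (thetaMul 1 z - thetaMul 4 z) := by
    simpa using hasSum_thetaMul_odd (t := 1) one_pos z
  have hs : Summable (fun m : ℤ ↦ cexp (2 * Real.pi * I * (((4 * m + 1) ^ 2 : ℤ) : ℂ) * z)) := by
    have := summable_cexp_sq_progression (t := 1) one_pos z (u := 4) (by norm_num) 1
    simpa using this
  set A := ∑' m : ℤ, cexp (2 * Real.pi * I * (((4 * m + 1) ^ 2 : ℤ) : ℂ) * z) with hA
  have hE : HasSum (fun j : ℤ ↦ cexp (2 * Real.pi * I * ((1 * (2 * (2 * j) + 1) ^ 2 : ℤ) : ℂ) * z)) A := by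
    convert hs.hasSum using 2 with j
    push_cast; ring_nf
  have hO : HasSum (fun j : ℤ ↦ cexp (2 * Real.pi * I * ((1 * (2 * (2 * j + 1) + 1) ^ 2 : ℤ) : ℂ) * z)) A := by
    have := (Equiv.subLeft (-1 : ℤ)).hasSum_iff.mpr hs.hasSum
    convert this using 2 with j
    simp only [Function.comp_apply, Equiv.subLeft_apply]
    push_cast; ring_nf
  have htot := ModularForms.hasSum_int_even_add_odd
    (f := fun m : ℤ ↦ cexp (2 * Real.pi * I * ((1 * (2 * m + 1) ^ 2 : ℤ) : ℂ) * z)) hE hO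
  have h2 := hg.unique htot
  have : A = (thetaMul 1 z - thetaMul 4 z) / 2 := by rw [h2]; ring
  rw [← this]
  exact hs.hasSum

/-- **`∑_n (-1)ⁿ e^{2πi 8n² z} = 2θ(32z) - θ(8z)`** (even `n` give `θ₃₂`, odd `n` give
`-(θ₈ - θ₃₂)`). [cite: Tunnell1983Congruent, Thm 1 p. 326 context] -/
theorem hasSum_sign_sq (z : ℍ) :
    HasSum (fun n : ℤ ↦ (-1 : ℂ) ^ n.natAbs * cexp (2 * Real.pi * I * ((8 * n ^ 2 : ℤ) : ℂ) * z))
      (2 * thetaMul 32 z - thetaMul 8 z) := by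
  have hE : HasSum (fun j : ℤ ↦ (-1 : ℂ) ^ (2 * j).natAbs *
      cexp (2 * Real.pi * I * ((8 * (2 * j) ^ 2 : ℤ) : ℂ) * z)) (thetaMul 32 z) := by
    have := hasSum_thetaMul (t := 32) (by norm_num) z
    convert this using 2 with j
    have he : Even (2 * j).natAbs := Int.natAbs_even.mpr (even_two_mul j)
    rw [he.neg_one_pow, one_mul]
    push_cast; ring_nf
  have hO : HasSum (fun j : ℤ ↦ (-1 : ℂ) ^ (2 * j + 1).natAbs *
      cexp (2 * Real.pi * I * ((8 * (2 * j + 1) ^ 2 : ℤ) : ℂ) * z))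
      (-(thetaMul 8 z - thetaMul 32 z)) := by
    have h8 := (hasSum_thetaMul_odd (t := 8) (by norm_num) z).neg
    have e : (fun j : ℤ ↦ (-1 : ℂ) ^ (2 * j + 1).natAbs *
        cexp (2 * Real.pi * I * ((8 * (2 * j + 1) ^ 2 : ℤ) : ℂ) * z)) =
        fun j : ℤ ↦ -cexp (2 * Real.pi * I * ((8 * (2 * j + 1) ^ 2 : ℤ) : ℂ) * z) := by
      funext j
      have ho : Odd (2 * j + 1).natAbs := Int.natAbs_odd.mpr (odd_two_mul_add_one j)
      rw [ho.neg_one_pow, neg_one_mul]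
    rw [e]
    rw [show (4 * 8 : ℕ) = 32 from rfl] at h8
    exact_mod_cast h8
  have htot := ModularForms.hasSum_int_even_add_odd
    (f := fun n : ℤ ↦ (-1 : ℂ) ^ n.natAbs * cexp (2 * Real.pi * I * ((8 * n ^ 2 : ℤ) : ℂ) * z)) hE hO
  convert htot using 1
  ring

/-- **`g = ½ (θ₁ - θ₄)(2θ₃₂ - θ₈)`**: Tunnell's `g(z) = ∑_{(m,n)} (-1)ⁿ q^{(4m+1)² + 8n²}` is the
product of the two one-variable series above. [cite: Tunnell1983Congruent, Thm 1 (p. 326)] -/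
theorem tunnellG_eq_thetaMul (z : ℍ) :
    tunnellG z = (thetaMul 1 z - thetaMul 4 z) / 2 * (2 * thetaMul 32 z - thetaMul 8 z) := by
  have hA := hasSum_four_mul_add_one_sq z
  have hB := hasSum_sign_sq z
  have hprod : Summable (fun p : ℤ × ℤ ↦
      cexp (2 * Real.pi * I * (((4 * p.1 + 1) ^ 2 : ℤ) : ℂ) * z) *
        ((-1 : ℂ) ^ p.2.natAbs * cexp (2 * Real.pi * I * ((8 * p.2 ^ 2 : ℤ) : ℂ) * z))) := by
    refine (summable_norm_gTerm z).of_norm.congr fun p ↦ ?_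
    rw [gTerm, mul_left_comm, ← Complex.exp_add]
    congr 2
    push_cast; ring
  have h := hA.mul hB hprod
  have hg : HasSum (fun p : ℤ × ℤ ↦
      cexp (2 * Real.pi * I * (((4 * p.1 + 1) ^ 2 : ℤ) : ℂ) * z) *
        ((-1 : ℂ) ^ p.2.natAbs * cexp (2 * Real.pi * I * ((8 * p.2 ^ 2 : ℤ) : ℂ) * z)))
      (tunnellG z) := by
    refine (hasSum_gTerm z).congr_fun fun p ↦ ?_
    rw [gTerm, mul_left_comm, ← Complex.exp_add]
    congr 2
    push_cast; ring
  exact hg.unique h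

/-! ### Periodicity under integer translations -/

/-- `θ_t(z + n) = θ_t(z)` for `n ∈ ℤ`. [folklore] -/
theorem thetaMul_vadd_intCast (t : ℕ) (n : ℤ) (z : ℍ) :
    thetaMul t (((n : ℝ)) +ᵥ z) = thetaMul t z := by
  unfold thetaMul
  refine tsum_congr fun m ↦ ?_
  rw [coe_vadd]
  push_cast
  exact cexp_eq_cexp_of_sub_eq (t * m ^ 2 * n) (by push_cast; ring)

/-- `g(z + n) = g(z)` for `n ∈ ℤ`. [folklore] -/
theorem tunnellG_vadd_intCast (n : ℤ) (z : ℍ) : tunnellG (((n : ℝ)) +ᵥ z) = tunnellG z := by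
  rw [tunnellG_eq_thetaMul, tunnellG_eq_thetaMul, thetaMul_vadd_intCast, thetaMul_vadd_intCast,
    thetaMul_vadd_intCast, thetaMul_vadd_intCast]

/-- `(g θ_t)(z + n) = (g θ_t)(z)` for `n ∈ ℤ`. [folklore] -/
theorem tunnellForm_vadd_intCast (t : ℕ) (n : ℤ) (z : ℍ) :
    tunnellForm t (((n : ℝ)) +ᵥ z) = tunnellForm t z := by
  rw [tunnellForm, tunnellForm, tunnellG_vadd_intCast, thetaMul_vadd_intCast]

/-- `θ₁ = θ`: `thetaMul 1` is Shimura's theta function. [folklore] -/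
theorem thetaMul_one_eq_shimuraTheta (z : ℍ) : thetaMul 1 z = shimuraTheta z := by
  rw [thetaMul_eq_shimuraTheta one_pos]
  congr 1
  apply UpperHalfPlane.ext
  change ((1 : ℕ) : ℂ) * z = z
  simp

/-- `θ(z + n) = θ(z)` for `n ∈ ℤ`. [folklore] -/
theorem shimuraTheta_vadd_intCast (n : ℤ) (z : ℍ) :
    shimuraTheta (((n : ℝ)) +ᵥ z) = shimuraTheta z := by
  rw [← thetaMul_one_eq_shimuraTheta, ← thetaMul_one_eq_shimuraTheta, thetaMul_vadd_intCast]

/-! ### `g(γz)` and `(g θ_t)(γz)` for `c > 0` -/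

section Pos

variable {γ : SL(2, ℤ)} {c : ℕ} [NeZero c]

/-- **`g(γz) = χ₈(a) μ(γ, z)² g(z)`** for `γ = (a b; c d)`, `c > 0`, `128 ∣ c`, where
`μ(γ, z) = (2ic/(cz + d))^{-1/2} G(a; c)` is the multiplier of `θ`: from
`g = ½ (θ₁ - θ₄)(2θ₃₂ - θ₈)` and `θ₁, θ₄ ↦ μ`, `θ₈, θ₃₂ ↦ χ₈(a) μ`.
[cite: Tunnell1983Congruent, Thm 1 (p. 326)] -/
theorem tunnellG_smul (hc : (γ 1 0 : ℤ) = c) (h128 : 128 ∣ c) (z : ℍ) :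
    tunnellG (γ • z) =
      ZMod.χ₈ (γ 0 0) *
        (1 / (2 * I * c / ((c : ℂ) * z + γ 1 1)) ^ (1 / 2 : ℂ) * quadGaussSum c (γ 0 0) 0) ^ 2 *
          tunnellG z := by
  rw [tunnellG_eq_thetaMul, tunnellG_eq_thetaMul, thetaMul_one_smul hc (dvd_trans ⟨32, rfl⟩ h128) z,
    thetaMul_four_smul hc (dvd_trans ⟨8, rfl⟩ h128) z, thetaMul_thirtytwo_smul hc h128 z,
    thetaMul_eight_smul hc (dvd_trans ⟨4, rfl⟩ h128) z]
  ring

/-- **`(g θ_t)(γz) θ(z)³ = χ₈(a) θ(γz)³ (g θ_t)(z)` for `t = 1, 4, 16`**, `c > 0`, `128 ∣ c`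
(`θ_t ↦ μ`, `g ↦ χ₈(a) μ²`, `θ ↦ μ`). [cite: Tunnell1983Congruent, Thm 2 (p. 327)] -/
theorem tunnellForm_smul_chi {t : ℕ} (ht : t = 1 ∨ t = 4 ∨ t = 16) (hc : (γ 1 0 : ℤ) = c)
    (h128 : 128 ∣ c) (z : ℍ) :
    tunnellForm t (γ • z) * shimuraTheta z ^ 3 =
      ZMod.χ₈ (γ 0 0) * shimuraTheta (γ • z) ^ 3 * tunnellForm t z := by
  have hrel : thetaMul t (γ • z) =
      1 / (2 * I * c / ((c : ℂ) * z + γ 1 1)) ^ (1 / 2 : ℂ) * quadGaussSum c (γ 0 0) 0 *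
        thetaMul t z := by
    rcases ht with rfl | rfl | rfl
    · exact thetaMul_one_smul hc (dvd_trans ⟨32, rfl⟩ h128) z
    · exact thetaMul_four_smul hc (dvd_trans ⟨8, rfl⟩ h128) z
    · exact thetaMul_sixteen_smul hc (dvd_trans ⟨2, rfl⟩ h128) z
  rw [tunnellForm, tunnellForm, tunnellG_smul hc h128, hrel, ← thetaMul_one_eq_shimuraTheta, ← thetaMul_one_eq_shimuraTheta,
    thetaMul_one_smul hc (dvd_trans ⟨32, rfl⟩ h128) z]
  ring

/-- **`(g θ_t)(γz) θ(z)³ = θ(γz)³ (g θ_t)(z)` for `t = 2, 8, 32`**, `c > 0`, `128 ∣ c`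
(`θ_t ↦ χ₈(a) μ`, `g ↦ χ₈(a) μ²`, `χ₈(a)² = 1`). [cite: Tunnell1983Congruent, Thm 2 (p. 327)] -/
theorem tunnellForm_smul_triv {t : ℕ} (ht : t = 2 ∨ t = 8 ∨ t = 32) (hc : (γ 1 0 : ℤ) = c)
    (h128 : 128 ∣ c) (z : ℍ) :
    tunnellForm t (γ • z) * shimuraTheta z ^ 3 = shimuraTheta (γ • z) ^ 3 * tunnellForm t z := by
  have hrel : thetaMul t (γ • z) =
      ZMod.χ₈ (γ 0 0) *
        (1 / (2 * I * c / ((c : ℂ) * z + γ 1 1)) ^ (1 / 2 : ℂ) * quadGaussSum c (γ 0 0) 0) *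
          thetaMul t z := by
    rcases ht with rfl | rfl | rfl
    · exact thetaMul_two_smul hc (dvd_trans ⟨16, rfl⟩ h128) z
    · exact thetaMul_eight_smul hc (dvd_trans ⟨4, rfl⟩ h128) z
    · exact thetaMul_thirtytwo_smul hc h128 z
  have ha : Odd (γ 0 0 : ℤ) := odd_entry_of_even hc (dvd_trans ⟨64, rfl⟩ h128)
  rw [tunnellForm, tunnellForm, tunnellG_smul hc h128, hrel, ← thetaMul_one_eq_shimuraTheta, ← thetaMul_one_eq_shimuraTheta,
    thetaMul_one_smul hc (dvd_trans ⟨32, rfl⟩ h128) z]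
  linear_combination ((1 / (2 * I * ↑c / (↑c * ↑z + ↑(γ 1 1))) ^ (1 / 2 : ℂ) *
    quadGaussSum c (γ 0 0 : ℤ) 0) ^ 3 * tunnellG z * thetaMul t z * thetaMul 1 z ^ 3) *
      χ₈_sq_of_odd ha

end Pos

/-! ### Automorphy on `Γ₀(128)` -/

/-- For `γ ∈ SL₂(ℤ)` with `c = 0`: `γz = z + ab` (`a = d = ±1`). [folklore] -/
theorem smul_eq_vadd_of_apply_one_zero_eq_zero {γ : SL(2, ℤ)} (hc : (γ 1 0 : ℤ) = 0) (z : ℍ) :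
    γ • z = (((γ 0 0 * γ 0 1 : ℤ) : ℝ)) +ᵥ z := by
  have h1 := det_eq_one' γ
  rw [hc, mul_zero, sub_zero] at h1
  apply UpperHalfPlane.ext
  rw [coe_smul_eq', coe_vadd, hc]
  push_cast
  rcases Int.eq_one_or_neg_one_of_mul_eq_one' h1 with ⟨ha, hd⟩ | ⟨ha, hd⟩
  · rw [ha, hd]; push_cast; ring
  · rw [ha, hd]; push_cast; ring

/-- The reduction of theta-automorphy on `Γ₀(128)` to the core identity for `c > 0`: given
`f(γz) θ(z)³ = η(a) θ(γz)³ f(z)` whenever `c > 0`, `128 ∣ c`, and `η(a) = χ(d)` on `Γ₀(128)` for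
`c ≠ 0`, and `χ(±1) = 1`, the form `f = g θ_t` is theta-automorphic of weight `3/2`, level `128`,
character `χ`. [folklore] -/
theorem isThetaAutomorphic_of_core {t : ℕ} (χ : DirichletCharacter ℂ 128) (η : ℤ → ℂ)
    (hcore : ∀ (γ : SL(2, ℤ)) (c : ℕ) [NeZero c], (γ 1 0 : ℤ) = c → 128 ∣ c → ∀ z : ℍ,
      tunnellForm t (γ • z) * shimuraTheta z ^ 3 =
        η (γ 0 0) * shimuraTheta (γ • z) ^ 3 * tunnellForm t z)
    (hχ : ∀ γ : SL(2, ℤ), γ ∈ Gamma0 128 → (γ 1 0 : ℤ) ≠ 0 →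
      η (γ 0 0) = χ ((γ 1 1 : ℤ) : ZMod 128))
    (hχ1 : χ ((1 : ℤ) : ZMod 128) = 1) (hχm1 : χ ((-1 : ℤ) : ZMod 128) = 1) :
    IsThetaAutomorphic 3 128 χ (tunnellForm t) := by
  intro γ hγ z
  have h128 : (128 : ℤ) ∣ γ 1 0 := (ZMod.intCast_zmod_eq_zero_iff_dvd _ 128).mp (Gamma0_mem.mp hγ)
  rcases lt_trichotomy (γ 1 0 : ℤ) 0 with hneg | hzero | hpos
  · -- `c < 0`: use `-γ`
    set γ' := -γ with hγ'
    have hc' : ((γ' 1 0 : ℤ)) = ((γ 1 0).natAbs : ℕ) := by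
      rw [hγ', SL_neg_apply, Int.ofNat_natAbs_of_nonpos hneg.le]
    haveI : NeZero (γ 1 0 : ℤ).natAbs := ⟨Int.natAbs_ne_zero.mpr hneg.ne⟩
    have hdvd : 128 ∣ (γ 1 0 : ℤ).natAbs := by
      have := Int.natAbs_dvd_natAbs.mpr h128
      simpa using this
    have key := hcore γ' _ hc' hdvd z
    rw [hγ', ModularGroup.SL_neg_smul] at key
    rw [key, hχ γ' (neg_mem_Gamma0 hγ) (by rw [hγ', SL_neg_apply]; omega), hγ', SL_neg_apply]
    push_cast
    rw [show (-(γ 1 1 : ℤ) : ZMod 128) = ((-1 : ℤ) : ZMod 128) * ((γ 1 1 : ℤ) : ZMod 128) by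
      push_cast; ring, map_mul, hχm1, one_mul]
  · -- `c = 0`: translation
    rw [smul_eq_vadd_of_apply_one_zero_eq_zero hzero, tunnellForm_vadd_intCast,
      shimuraTheta_vadd_intCast]
    have h1 := det_eq_one' γ
    rw [hzero, mul_zero, sub_zero] at h1
    rcases Int.eq_one_or_neg_one_of_mul_eq_one' h1 with ⟨_, hd⟩ | ⟨_, hd⟩
    · rw [hd, hχ1]; ring
    · rw [hd, hχm1]; ring
  · -- `c > 0`
    have hc' : ((γ 1 0 : ℤ)) = ((γ 1 0).natAbs : ℕ) := (Int.natAbs_of_nonneg hpos.le).symm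
    haveI : NeZero (γ 1 0 : ℤ).natAbs := ⟨Int.natAbs_ne_zero.mpr hpos.ne'⟩
    have hdvd : 128 ∣ (γ 1 0 : ℤ).natAbs := by
      have := Int.natAbs_dvd_natAbs.mpr h128
      simpa using this
    rw [hcore γ _ hc' hdvd z, hχ γ hγ hpos.ne']

/-- `χ₈(a) = χ₈(d)` for `γ = (a b; c d) ∈ Γ₀(8·)`: `ad ≡ 1 (mod 8)`. [folklore] -/
theorem χ₈_entry_eq {γ : SL(2, ℤ)} (h8 : (8 : ℤ) ∣ γ 1 0) :
    ZMod.χ₈ (γ 0 0) = ZMod.χ₈ (γ 1 1) := by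
  have h1 := det_eq_one' γ
  have had : ((γ 0 0 : ℤ) : ZMod 8) * ((γ 1 1 : ℤ) : ZMod 8) = 1 := by
    have : ((γ 0 0 * γ 1 1 - γ 0 1 * γ 1 0 : ℤ) : ZMod 8) = ((1 : ℤ) : ZMod 8) := by rw [h1]
    push_cast at this
    rw [(ZMod.intCast_zmod_eq_zero_iff_dvd _ 8).mpr h8, mul_zero, sub_zero] at this
    exact this
  have hq := ZMod.isQuadratic_χ₈
  have hu : IsUnit (((γ 1 1 : ℤ) : ZMod 8)) := IsUnit.of_mul_eq_one _ (by rw [mul_comm]; exact had)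
  have hprod : ZMod.χ₈ (γ 0 0) * ZMod.χ₈ (γ 1 1) = 1 := by
    rw [← map_mul, had, map_one]
  rcases hq ((γ 1 1 : ℤ) : ZMod 8) with h0 | h | h
  · exact absurd h0 (hu.map ZMod.χ₈).ne_zero
  · rw [h, mul_one] at hprod; rw [hprod, h]
  · rw [h, mul_neg, mul_one, neg_eq_iff_eq_neg] at hprod; rw [hprod, h]

/-- **Tunnell's Theorem 2, automorphy part, character `χ₂`**: for `t = 1, 4, 16` the form `g θ_t`
satisfies `(g θ_t)(γz) θ(z)³ = χ₂(d) θ(γz)³ (g θ_t)(z)` for all `γ ∈ Γ₀(128)`, i.e. it is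
theta-automorphic of weight `3/2`, level `128` and character `χ₂ = tunnellChar`
(`Literature.NumberTheory.EllipticCurves.ModularForms.IsThetaAutomorphic`).
[cite: Tunnell1983Congruent, Thm 2 (p. 327)] -/
theorem isThetaAutomorphic_tunnellForm_chi {t : ℕ} (ht : t = 1 ∨ t = 4 ∨ t = 16) :
    IsThetaAutomorphic 3 128 tunnellChar (tunnellForm t) := by
  refine isThetaAutomorphic_of_core tunnellChar (fun a ↦ ((ZMod.χ₈ a : ℤ) : ℂ))
    (fun γ c _ hc h128 z ↦ tunnellForm_smul_chi ht hc h128 z) (fun γ hγ hc0 ↦ ?_) ?_ ?_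
  · -- `χ₈(a) = χ₂(d)`
    have h128 : (128 : ℤ) ∣ γ 1 0 := (ZMod.intCast_zmod_eq_zero_iff_dvd _ 128).mp (Gamma0_mem.mp hγ)
    have hcop : IsCoprime (γ 1 1 : ℤ) (128 : ℕ) := by
      have h1 := det_eq_one' γ
      have : IsCoprime (γ 1 1 : ℤ) (γ 1 0) := ⟨γ 0 0, -γ 0 1, by linear_combination h1⟩
      exact this.of_isCoprime_of_dvd_right (by exact_mod_cast h128)
    rw [tunnellChar, DirichletCharacter.changeLevel_eq_cast_of_dvd' _ _ hcop,
      MulChar.ringHomComp_apply, χ₈_entry_eq (dvd_trans ⟨16, by norm_num⟩ h128)]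
    simp
  · rw [tunnellChar, DirichletCharacter.changeLevel_eq_cast_of_dvd' _ _ isCoprime_one_left]
    simp
  · have : IsCoprime (-1 : ℤ) (128 : ℕ) := (isCoprime_one_left).neg_left
    rw [tunnellChar, DirichletCharacter.changeLevel_eq_cast_of_dvd' _ _ this,
      MulChar.ringHomComp_apply]
    rw [show ((-1 : ℤ) : ZMod 8) = 7 from rfl, show ZMod.χ₈ (7 : ZMod 8) = 1 from rfl]
    simp

/-- **Tunnell's Theorem 2, automorphy part, trivial character**: for `t = 2, 8, 32` the form
`g θ_t` satisfies `(g θ_t)(γz) θ(z)³ = θ(γz)³ (g θ_t)(z)` for all `γ ∈ Γ₀(128)` (theta-automorphic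
of weight `3/2`, level `128`, trivial character). [cite: Tunnell1983Congruent, Thm 2 (p. 327)] -/
theorem isThetaAutomorphic_tunnellForm_triv {t : ℕ} (ht : t = 2 ∨ t = 8 ∨ t = 32) :
    IsThetaAutomorphic 3 128 1 (tunnellForm t) := by
  refine isThetaAutomorphic_of_core 1 (fun _ ↦ 1)
    (fun γ c _ hc h128 z ↦ by rw [one_mul]; exact tunnellForm_smul_triv ht hc h128 z)
    (fun γ hγ hc0 ↦ ?_) ?_ ?_
  · have h128 : (128 : ℤ) ∣ γ 1 0 := (ZMod.intCast_zmod_eq_zero_iff_dvd _ 128).mp (Gamma0_mem.mp hγ)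
    have hcop : IsCoprime (γ 1 1 : ℤ) ((128 : ℕ) : ℤ) := by
      have h1 := det_eq_one' γ
      have : IsCoprime (γ 1 1 : ℤ) (γ 1 0) := ⟨γ 0 0, -γ 0 1, by linear_combination h1⟩
      exact this.of_isCoprime_of_dvd_right (by exact_mod_cast h128)
    have hu : IsUnit (((γ 1 1 : ℤ) : ZMod 128)) := by
      rw [← ZMod.coe_unitOfIsCoprime _ hcop]; exact Units.isUnit _
    rw [MulChar.one_apply hu]
  · rw [Int.cast_one, map_one]
  · have hu : IsUnit (((-1 : ℤ) : ZMod 128)) := by push_cast; exact isUnit_one.neg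
    rw [MulChar.one_apply hu]

end Literature.NumberTheory.EllipticCurves.Tunnell1983
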